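import Summits.NavierStokesRegularity.NavierStokesRegularity.Theses.TypeICertificateLadder
import Literature.Analysis.FluidPDE.NSBoundedMildOseen
import Literature.Analysis.FluidPDE.KochTataruKernel

/-!
# Sketch — crux-ideate `stmt-NavierStokesRegularity-2881` (`TypeIConcentration`), ideator 3

First-lemma signatures for the two idea cards

* `Ideas/receding-shield-leray-tracking.md`  (Card 1): `NoNucleation`, `LerayFloorTracking`,
  `GradientUnderEnvelope`, and the target shape `crux_of_card1`.
* `Ideas/quiet-point-subcritical-upgrade.md` (Card 2): `QuietDecayUpgrade`, `QuietImpliesBounded`,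
  `EverySingularPointLoud`.

Everything is stated over accepted declarations (`IsClassicalNSSolutionOn`, `IsLerayHopfOn`,
`HasRapidSpatialDecay`, `HasSmoothExtensionPast`, `oseenKernel`); nothing is proved here.
-/

noncomputable section

open MeasureTheory Set Filter Topology Metric
open scoped ENNReal

namespace Summit.NavierStokesRegularity.NavierStokesRegularity.Cruxes.TypeIConcentration.Sketch

open Literature.Analysis.FluidPDE

local notation "E3" => EuclideanSpace ℝ (Fin 3)

/-- The pointwise Type-I(C) ENVELOPE on the time window `[t, T)` (all of space):
`√(T-s) ‖u s x‖ ≤ C √ν`. -/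
def Envelope (C ν T t : ℝ) (u : ℝ → E3 → E3) : Prop :=
  ∀ s ∈ Ico t T, ∀ x : E3, Real.sqrt (T - s) * ‖u s x‖ ≤ C * Real.sqrt ν

/-- QUIET similarity ball: at time `t`, `√(T-t) ‖u t y‖ ≤ a √ν` on the closed ball of radius
`R √(ν (T - t))` about `x₀`. -/
def Quiet (a R ν T t : ℝ) (u : ℝ → E3 → E3) (x₀ : E3) : Prop :=
  ∀ y ∈ closedBall x₀ (R * Real.sqrt (ν * (T - t))), Real.sqrt (T - t) * ‖u t y‖ ≤ a * Real.sqrt ν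

/-- **Card 1, first lemma (NO-NUCLEATION / receding shield).** There is a universal `c₀ > 0`
(`c₀ = 1/(32 C_K π³)`, `C_K` the Oseen-kernel constant) such that for every Type-I constant `C`
and every threshold `0 < c ≤ c₀` there is a radius `ρ = ρ(C,c) = O(C² log(C/c)/c)` such that: under the envelope on `[t,T)`, a
similarity ball of radius `ρ` that is `c`-quiet at time `t` stays `4c`-quiet on the unit
similarity ball (radius `√(ν(T-t))`, fixed physical ball) for ALL later times `s < T`.
Proof route A: touching-point argument on the mild formula from time `t` with the parabolically
receding control region `closedBall x₀ (√(ν(T-t)) + λ √(ν(T-s)))`, Oseen-kernel tail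
`∫_{|z|>D} (a+|z|²)⁻² ≤ 4π/D`, `∫ (a+|z|²)⁻² = π²/√a`; route B: KNSS weak-* compactness +
small-data rigidity (non-explicit `ρ`). -/
def NoNucleation : Prop :=
  ∃ c₀ : ℝ, 0 < c₀ ∧ ∀ C : ℝ, 0 < C → ∀ c : ℝ, 0 < c → c ≤ c₀ → ∃ ρ : ℝ, 1 < ρ ∧
    ∀ (ν T t : ℝ), 0 < ν → 0 ≤ t → t < T →
    ∀ (u : ℝ → E3 → E3) (p : ℝ → E3 → ℝ),
      IsClassicalNSSolutionOn (Ico 0 T) ν 0 u p → IsLerayHopfOn T ν 0 (u 0) u →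
      Envelope C ν T t u →
      ∀ x₀ : E3, Quiet c ρ ν T t u x₀ →
        ∀ s ∈ Ico t T, ∀ y ∈ closedBall x₀ (Real.sqrt (ν * (T - t))),
          Real.sqrt (T - s) * ‖u s y‖ ≤ 4 * c * Real.sqrt ν

/-- **Card 1, second lemma (LERAY-FLOOR TRACKING).** Under the envelope on `[t₁,T)` and
maximality (no classical extension past `T`), if loud points can only appear within
`ρ √(ν(T-t))` of earlier loud points (the contrapositive of `NoNucleation`) then, by Leray's
floor `‖u(s)‖_∞ ≥ c_L √ν/√(T-s)` (`leray_blowup_rate_top_holds`) and Bolzano–Weierstrass on the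
nested bounded loud sets, ONE point `x₀` sees a `c`-loud point within `ρ √(ν(T-t))` at EVERY
time `t ∈ (t₁, T)`. Stated here as the conclusion to be derived. -/
def LerayFloorTracking : Prop :=
  ∀ C : ℝ, 0 < C → ∃ c : ℝ, 0 < c ∧ ∃ ρ : ℝ, 0 < ρ ∧
    ∀ (ν T t₁ : ℝ), 0 < ν → 0 ≤ t₁ → t₁ < T →
    ∀ (u : ℝ → E3 → E3) (p : ℝ → E3 → ℝ),
      IsClassicalNSSolutionOn (Ico 0 T) ν 0 u p → IsLerayHopfOn T ν 0 (u 0) u →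
      HasRapidSpatialDecay (u 0) → Envelope C ν T t₁ u → ¬ HasSmoothExtensionPast ν 0 u T →
      ∃ x₀ : E3, ∀ t ∈ Ioo t₁ T, ∃ y ∈ closedBall x₀ (ρ * Real.sqrt (ν * (T - t))),
        c * Real.sqrt ν ≤ Real.sqrt (T - t) * ‖u t y‖

/-- **Card 1, third lemma (GRADIENT UNDER THE ENVELOPE)**, from `knss2009_local_smoothing_holds`
(`k = 1`, `l = 0`) applied on the window `[t - ε(T-t)/C², t]` and `oseenMild_bounded_unique`:
`‖∇u(t,x)‖ ≤ C₁(C)/(T-t)` (the viscosity cancels), `C₁(C) = O(C²)`. Written with the Fréchet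
derivative of the slice. -/
def GradientUnderEnvelope : Prop :=
  ∀ C : ℝ, 0 < C → ∃ C₁ : ℝ, 0 < C₁ ∧
    ∀ (ν T t₁ : ℝ), 0 < ν → 0 ≤ t₁ → t₁ < T →
    ∀ (u : ℝ → E3 → E3) (p : ℝ → E3 → ℝ),
      IsClassicalNSSolutionOn (Ico 0 T) ν 0 u p → IsLerayHopfOn T ν 0 (u 0) u →
      Envelope C ν T t₁ u →
      ∀ t ∈ Ioo ((t₁ + T) / 2) T, ∀ x : E3, (T - t) * ‖fderiv ℝ (u t) x‖ ≤ C₁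

/-- The elementary conversion used by both cards: a `c`-loud point plus the gradient bound gives
`L³` mass `(π/48) c⁶/C₁³ · ν³` on the ball of radius `(c/(2C₁)) √(ν(T-t))` about it (pure
calculus: `‖u‖ ≥ c√ν/(2√(T-t))` on that ball). -/
def LoudPointGivesMass : Prop :=
  ∀ (c C₁ ν T t : ℝ), 0 < c → 0 < C₁ → 0 < ν → t < T →
    ∀ (v : E3 → E3), Differentiable ℝ v → (∀ x, (T - t) * ‖fderiv ℝ v x‖ ≤ C₁) →
    ∀ y : E3, c * Real.sqrt ν ≤ Real.sqrt (T - t) * ‖v y‖ →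
      Real.pi / 48 * (c ^ 6 / C₁ ^ 3) * ν ^ 3 ≤
        ∫ x in ball y (c / (2 * C₁) * Real.sqrt (ν * (T - t))), ‖v x‖ ^ 3

/-- Target shape for Card 1: the crux from the three lemmas (plus `LoudPointGivesMass`). -/
def CruxOfCard1 : Prop :=
  NoNucleation → LerayFloorTracking → GradientUnderEnvelope → LoudPointGivesMass →
    Theses.TypeICertificateLadder.TypeIConcentration

/-- **Card 2, first lemma (SELF-IMPROVING SHIELD / subcritical upgrade).** With the control
region receding POLYNOMIALLY, `closedBall x₀ ((1 + λ ((T-s)/(T-t))^{1/16}) √(ν(T-t)))`, the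
same touching-point bootstrap closes with the decaying profile
`√(T-s)‖u s y‖ ≤ 4c √ν ((T-s)/(T-t))^{3/8}`, i.e. the quiet unit similarity ball is
SUBCRITICAL: `‖u s y‖ ≤ 4c √ν (T-t)^{-3/8} (T-s)^{-1/8}`. -/
def QuietDecayUpgrade : Prop :=
  ∃ c₀ : ℝ, 0 < c₀ ∧ ∀ C : ℝ, 0 < C → ∀ c : ℝ, 0 < c → c ≤ c₀ → ∃ ρ : ℝ, 1 < ρ ∧
    ∀ (ν T t : ℝ), 0 < ν → 0 ≤ t → t < T →
    ∀ (u : ℝ → E3 → E3) (p : ℝ → E3 → ℝ),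
      IsClassicalNSSolutionOn (Ico 0 T) ν 0 u p → IsLerayHopfOn T ν 0 (u 0) u →
      Envelope C ν T t u →
      ∀ x₀ : E3, Quiet c ρ ν T t u x₀ →
        ∀ s ∈ Ico t T, ∀ y ∈ closedBall x₀ (Real.sqrt (ν * (T - t))),
          ‖u s y‖ ≤ 4 * c * Real.sqrt ν * (T - t) ^ (-(3 / 8 : ℝ)) * (T - s) ^ (-(1 / 8 : ℝ))

/-- **Card 2, second lemma (QUIET ⟹ BOUNDED near `(T, x₀)`)**: plug the subcritical inside bound
and the ENERGY-CAPPED far field (`‖u(σ)‖₂ ≤ ‖u 0‖₂`, kernel `sup_{|z|≥D} ≤ C_K (νθ + D²)⁻²`)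
into the mild formula once more: `u` is bounded on `ball x₀ (½√(ν(T-t))) × (t, T)` (bound
depending on the solution, which is fine for regularity). -/
def QuietImpliesBounded : Prop :=
  ∀ C : ℝ, 0 < C → ∃ c : ℝ, 0 < c ∧ ∃ ρ : ℝ, 1 < ρ ∧
    ∀ (ν T t : ℝ), 0 < ν → 0 ≤ t → t < T →
    ∀ (u : ℝ → E3 → E3) (p : ℝ → E3 → ℝ),
      IsClassicalNSSolutionOn (Ico 0 T) ν 0 u p → IsLerayHopfOn T ν 0 (u 0) u →
      Envelope C ν T t u →
      ∀ x₀ : E3, Quiet c ρ ν T t u x₀ →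
        ∃ K : ℝ, ∀ s ∈ Ioo t T, ∀ y ∈ ball x₀ (Real.sqrt (ν * (T - t)) / 2), ‖u s y‖ ≤ K

/-- **Card 2, crux-strength conclusion (EVERY singular point is loud at EVERY time)** — the
pointwise-Type-I analogue of Barker–Prange 2020 Thm 2 / 2021 Cor. 12 with explicit
`ρ(C), γ(C)`: if `u` is unbounded near `(T, x₀)` (backward cylinders) then the `L³` mass on
`ball x₀ (ρ √(ν(T-t)))` is `≥ γ ν³` for all `t` in the envelope window. -/
def EverySingularPointLoud : Prop :=
  ∀ C : ℝ, 0 < C → ∃ ρ : ℝ, 0 < ρ ∧ ∃ γ : ℝ, 0 < γ ∧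
    ∀ (ν T t₁ : ℝ), 0 < ν → 0 ≤ t₁ → t₁ < T →
    ∀ (u : ℝ → E3 → E3) (p : ℝ → E3 → ℝ),
      IsClassicalNSSolutionOn (Ico 0 T) ν 0 u p → IsLerayHopfOn T ν 0 (u 0) u →
      Envelope C ν T t₁ u →
      ∀ x₀ : E3, (∀ r : ℝ, 0 < r → ∀ K : ℝ, ∃ s ∈ Ioo (T - r ^ 2) T, ∃ y ∈ ball x₀ r, K < ‖u s y‖) →
        ∀ t ∈ Ioo t₁ T, γ * ν ^ 3 ≤ ∫ x in ball x₀ (ρ * Real.sqrt (ν * (T - t))), ‖u t x‖ ^ 3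

/-- Target shape for Card 2: the crux from `EverySingularPointLoud` plus the existence of a
finite singular point for a non-extendable enveloped solution (continuation criterion
`hasSmoothExtensionPast_of_bounded_holds` + far-field quietness at `t₁` + `QuietImpliesBounded`). -/
def CruxOfCard2 : Prop :=
  QuietDecayUpgrade → QuietImpliesBounded → EverySingularPointLoud →
    Theses.TypeICertificateLadder.TypeIConcentration

/-- The Oseen-kernel TAIL bound both cards rest on (pure real analysis over the accepted
`oseenKernel`; the pointwise bound is the proved `exists_norm_oseenKernel_le`):
`∫_{‖z‖ ≥ D} ‖K(τ,z)[a,b]‖ dz ≤ (4π C_K / D) ‖a‖ ‖b‖` and `∫ ‖K(τ,z)[a,b]‖ dz ≤ (π² C_K/√τ) ‖a‖ ‖b‖`. -/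
def OseenTailBound : Prop :=
  ∃ CK : ℝ, 0 < CK ∧ ∀ τ : ℝ, 0 < τ → ∀ a b : E3,
    (∫ z, ‖oseenKernel τ z a b‖ ≤ CK * Real.pi ^ 2 / Real.sqrt τ * ‖a‖ * ‖b‖) ∧
    ∀ D : ℝ, 0 < D → ∫ z in {z : E3 | D ≤ ‖z‖}, ‖oseenKernel τ z a b‖ ≤ CK * (4 * Real.pi / D) * ‖a‖ * ‖b‖

example : Prop := Theses.TypeICertificateLadder.TypeIConcentration

end Summit.NavierStokesRegularity.NavierStokesRegularity.Cruxes.TypeIConcentration.Sketch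

end
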